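import Literature.Probability.FitznerVanDerHofstad2017.NobleBubbleLetterSums
import Literature.Probability.FitznerVanDerHofstad2017.NobleElementsClosedForms
import Literature.Probability.FitznerVanDerHofstad2017.NoblePeelExactLeg
import HarnessLib

/-!
# [NoBLE17] (5.41): the repulsive TRIANGLE letter at remainder slots, `∑'`/`ofReal` shape, and `(A^ι)_{0,2}` in tier P⁺

Sources.  [NoBLE17] = R. Fitzner, R. van der Hofstad, *Generalized approach to the non-backtracking lace expansion*,
Probab. Theory Relat. Fields **169** (2017) 1041–1119, §5.3.2 "Bounds on repulsive diagrams", display (5.41)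
(PTRF p. 1098): the repulsive triangle `𝓣_{≥m₁,≥m₂,≥m₃}` summed over its two free vertices is bounded by the explicit
short part (trail words of length `L < M`, multiplicity `binom(L+2−m, 2)`, `m = m₁+m₂+m₃`) plus three remainder terms
at the cut-off `M` carrying `Γ̄₂, Γ̄₂², Γ̄₂³` and remainder-kernel constants.  [FvdH17] = R. Fitzner, R. van der
Hofstad, *Mean-field behavior for nearest-neighbor percolation in `d > 10`*, Electron. J. Probab. **22** (2017) no. 43,
arXiv:1506.07977v2: §4.2 (4.17), (4.18) and the display after it (p. 36) (the instance's triangle letter is the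
repulsive triangle diagram); §5.1 "Elements of the bounds" (p. 49) and App. B Table "definition of
`A^{ι,a,b}(0,v,x,y)`", row `a = 0, b = 2` (p. 75): `(A^ι)_{0,2} = Σ_{x,y} Σ_κ (1−δ_{y,0})(1−δ_{x,0}) S_{1̲,0,2,1}(e_κ,x,y,0)`;
§4.2 (4.17) and the sentence after it (p. 36), §4.4 (4.65), §6.1 after (6.4) (pp. 43, 58): the exact first bond
of the square `𝓢_{1̲,0,2,1}(e_κ,x,y,0)` is the witness of its first line, the other witnesses avoid it, and integrating
it out peels it off at the price `p`, leaving the triangle `𝓣_{≥0,≥2,≥1}(x−e_κ, y−e_κ, −e_κ)` (landed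
`NoblePeelExactLeg.perc_S_eqOne₁_le_p_mul_T`).

What this module adds (node N76-EXL of the claim table, cell "Aiota[0,2]", tier P⁺ = PEEL-FIRST + triangle slot; the
triangle analogue of `NobleBubbleLetterSums` §A–B was not in the tree):

* §A `triangleSlotR p Γ̄ m₁ m₂ m₃ M N R₁ R₂ R₃` — the (5.41) right-hand side as a total real function of a trail-word
  majorant `N`, with `triangleSlotR_mono_count`, `triangleSlotR_nonneg`;
* §B `tsum_tsum_perc_T_ge_le_ofReal` — **`Σ'_v Σ'_y 𝓣_{≥m₁,≥m₂,≥m₃}(v,y,x) ≤ ofReal (triangleSlotR p Γ̄₂ m₁ m₂ m₃ M N R₁ R₂ R₃)`**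
  for `x ∈ X`, `N` majorising the trail-word counts to `x`, `R₁,R₂,R₃` remainder-kernel constants on `X`
  (`d ≥ 2`, `p < p_c`, `m₂+m₃ ≤ M`): every finite double partial sum is below the right-hand side by the landed
  finite-set form `sum_sum_perc_T_toReal_le_slots`, and the double `∑'` is their supremum; a weighted form
  `tsum_tsum_mul_perc_T_ge_le_ofReal` (weights `≤ 1`, e.g. Kronecker complements) and the arbitrary-index form
  `tsum_tsum_perc_T_le_ofReal_floor` (exact indices majorised by their floors, [FvdH17] (4.12));
* §C `perc_matAiota_zero_two_le_peel` — **`(A^ι)_{0,2}(perc) ≤ ofReal (2d · p · triangleSlotR p Γ̄₂ 0 2 1 M N R₁ R₂ R₃)`**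
  with `N, R₁, R₂, R₃` on the unit-vector endpoint class `range stepVec` (closed form `matAiota_zero_two`, peel of the
  exact first bond, re-indexing by `−e_κ`, the §B slot at the endpoint `−e_κ = e_{κ̄}`).

Relation to what is landed: the closed triangle at the apex `0` in the PRINTED currency (`trianglePrintedR`, closed
trail-word counts, `Γ₁, Γ₂`, `d ≥ 7`) is `NobleEntryVecPETwo.tsum_tsum_perc_T_zero_le_ofReal`; the present module is the
general-apex remainder-slot currency (`x ∈ X`, count majorant `N`, kernel constants `R₁, R₂, R₃`, `d ≥ 2`) — the
relation `bubbleSlotR` : `bubblePrintedRN` one diagram order up — which is what a unit-vector apex `−e_κ` needs.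

Everything is `d`-generic and unconditional in `p < p_c(d)`; no numeral is evaluated here (the numerical values of
`triangleSlotR` at `d = 11` belong to the verification notebook [FvdH17, §5.3]); nothing is cited as a hypothesis.
-/

noncomputable section

namespace Literature.Probability.FitznerVanDerHofstad2017.NobleBlocks

open _root_.MeasureTheory Finset
open scoped BigOperators ENNReal
open Literature.Probability.LatticeModels Literature.Probability.Percolation
open Literature.Barriers.CriticalPhenomena
open Literature.Probability.FitznerVanDerHofstad2017

variable {d : ℕ}

/-! ## A. The (5.41) right-hand side as a total real function -/

/-- The right-hand side of [NoBLE17] (5.41) at line indices `(m₁, m₂, m₃)` (`m = m₁+m₂+m₃`) and cut-off `M`, with the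
trail-word count read through a majorant `N L`, `Γ̄ = Γ̄₂(p)` and remainder-kernel constants `R₁, R₂, R₃`:
`Σ_{L ∈ [m, M)} binom(L+2−m,2)·N L·p^L + binom(M+1−m,2)·p^M·Γ̄·R₁ + (M−m)·p^M·Γ̄²·R₂ + p^M·Γ̄³·R₃`.
[cite: FitznerVanDerHofstad2016NoBLE, §5.3.2 (5.41) (PTRF 169 (2017) p. 1098)] -/
def triangleSlotR (p Γbar : ℝ) (m₁ m₂ m₃ M : ℕ) (N : ℕ → ℕ) (R₁ R₂ R₃ : ℝ) : ℝ :=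
  (∑ L ∈ Finset.Ico (m₁ + m₂ + m₃) M,
      (((L + 2 - (m₁ + m₂ + m₃)).choose 2 : ℕ) : ℝ) * (N L : ℝ) * p ^ L) +
    (((M + 1 - (m₁ + m₂ + m₃)).choose 2 : ℕ) : ℝ) * (p ^ M * (Γbar * R₁)) +
      ((M - (m₁ + m₂ + m₃) : ℕ) : ℝ) * (p ^ M * (Γbar ^ 2 * R₂)) + p ^ M * (Γbar ^ 3 * R₃)

/-- Monotonicity of the (5.41) right-hand side in the trail-word count (`#trailWordsTo d L x ≤ N L`, `0 ≤ p`).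
[cite: FitznerVanDerHofstad2016NoBLE, §5.3.2 (5.41) (PTRF 169 (2017) p. 1098)] -/
theorem triangleSlotR_mono_count {p Γbar : ℝ} (hp : 0 ≤ p) (m₁ m₂ m₃ M : ℕ) {x : Site d} {N : ℕ → ℕ}
    (hN : ∀ L, (trailWordsTo d L x).card ≤ N L) (R₁ R₂ R₃ : ℝ) :
    (∑ L ∈ Finset.Ico (m₁ + m₂ + m₃) M,
        (((L + 2 - (m₁ + m₂ + m₃)).choose 2 : ℕ) : ℝ) * ((trailWordsTo d L x).card : ℝ) * p ^ L) +
      (((M + 1 - (m₁ + m₂ + m₃)).choose 2 : ℕ) : ℝ) * (p ^ M * (Γbar * R₁)) +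
        ((M - (m₁ + m₂ + m₃) : ℕ) : ℝ) * (p ^ M * (Γbar ^ 2 * R₂)) + p ^ M * (Γbar ^ 3 * R₃) ≤
      triangleSlotR p Γbar m₁ m₂ m₃ M N R₁ R₂ R₃ := by
  unfold triangleSlotR
  gcongr with L hL
  exact_mod_cast hN L

/-- `0 ≤ triangleSlotR` for non-negative `p, Γ̄, R₁, R₂, R₃`.
[cite: FitznerVanDerHofstad2016NoBLE, §5.3.2 (5.41) (PTRF 169 (2017) p. 1098)] -/
theorem triangleSlotR_nonneg {p Γbar : ℝ} (hp : 0 ≤ p) (hΓ : 0 ≤ Γbar) (m₁ m₂ m₃ M : ℕ) (N : ℕ → ℕ)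
    {R₁ R₂ R₃ : ℝ} (hR₁ : 0 ≤ R₁) (hR₂ : 0 ≤ R₂) (hR₃ : 0 ≤ R₃) :
    0 ≤ triangleSlotR p Γbar m₁ m₂ m₃ M N R₁ R₂ R₃ := by
  unfold triangleSlotR
  positivity

/-! ## B. The passage from finite vertex sets to the double `∑'` -/

/-- **[NoBLE17] (5.41) for the instance's triangle letter, `∑'`/`ofReal` shape**: for `x ∈ X`,
`Σ'_v Σ'_y 𝓣_{≥m₁,≥m₂,≥m₃}(v,y,x) ≤ ofReal (triangleSlotR p Γ̄₂ m₁ m₂ m₃ M N R₁ R₂ R₃)` whenever `N` majorises the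
trail-word counts to `x` and `R₁, R₂, R₃` are remainder-kernel constants on `X` (`d ≥ 2`, `p < p_c`, `m₂ + m₃ ≤ M`).
Every finite double partial sum (over a finite set of pairs `(v,y)`, enlarged to the product of its projections) is
below the right-hand side by `sum_sum_perc_T_toReal_le_slots`; the double `∑'` is the supremum of those.
[cite: FitznerVanDerHofstad2016NoBLE, §5.3.2 (5.41) (PTRF 169 (2017) p. 1098)]
[cite: FitznerVanDerHofstad2017, §4.2 (4.17), (4.18) and the display after it (arXiv:1506.07977v2 p. 36)] -/
theorem tsum_tsum_perc_T_ge_le_ofReal (hd : 2 ≤ d) (p : unitInterval) (hp : p < criticalProbI d) {m₁ m₂ m₃ M : ℕ}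
    (hm : m₂ + m₃ ≤ M) {x : Site d} {X : Set (Site d)} (hx : x ∈ X) {N : ℕ → ℕ}
    (hN : ∀ L, (trailWordsTo d L x).card ≤ N L) {R₁ R₂ R₃ : ℝ} (hR₁ : IsRemKernelConst d [M] X R₁)
    (hR₂ : IsRemKernelConst d [M - m₃, m₃] X R₂) (hR₃ : IsRemKernelConst d [M - (m₂ + m₃), m₂, m₃] X R₃) :
    ∑' v, ∑' y, (Letters.perc d p).T (.ge m₁) (.ge m₂) (.ge m₃) v y x ≤
      ENNReal.ofReal (triangleSlotR p (nobleSup2 d p) m₁ m₂ m₃ M N R₁ R₂ R₃) := by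
  classical
  set f : Site d → Site d → ℝ≥0∞ := fun v y => (Letters.perc d p).T (.ge m₁) (.ge m₂) (.ge m₃) v y x with hf
  have hfin : ∀ S₁ S₂ : Finset (Site d), ∑ v ∈ S₁, ∑ y ∈ S₂, f v y ≤
      ENNReal.ofReal (triangleSlotR p (nobleSup2 d p) m₁ m₂ m₃ M N R₁ R₂ R₃) := by
    intro S₁ S₂
    have hT : ∀ v y, f v y = ENNReal.ofReal ((f v y).toReal) := fun v y =>
      (ENNReal.ofReal_toReal ((perc_T_le_one p _ _ _ _ _ _).trans_lt ENNReal.one_lt_top).ne).symm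
    calc ∑ v ∈ S₁, ∑ y ∈ S₂, f v y = ∑ v ∈ S₁, ∑ y ∈ S₂, ENNReal.ofReal ((f v y).toReal) :=
          Finset.sum_congr rfl fun v _ => Finset.sum_congr rfl fun y _ => hT v y
      _ = ENNReal.ofReal (∑ v ∈ S₁, ∑ y ∈ S₂, (f v y).toReal) := by
          rw [ENNReal.ofReal_sum_of_nonneg fun v _ => Finset.sum_nonneg fun y _ => ENNReal.toReal_nonneg]
          exact Finset.sum_congr rfl fun v _ =>
            (ENNReal.ofReal_sum_of_nonneg fun y _ => ENNReal.toReal_nonneg).symm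
      _ ≤ _ := ENNReal.ofReal_le_ofReal ((sum_sum_perc_T_toReal_le_slots p hd hp hm hx hR₁ hR₂ hR₃ S₁ S₂).trans
            (triangleSlotR_mono_count p.2.1 m₁ m₂ m₃ M hN R₁ R₂ R₃))
  rw [← ENNReal.tsum_prod, ENNReal.tsum_eq_iSup_sum]
  refine iSup_le fun S => ?_
  calc ∑ q ∈ S, f q.1 q.2 ≤ ∑ q ∈ S.image Prod.fst ×ˢ S.image Prod.snd, f q.1 q.2 :=
        Finset.sum_le_sum_of_subset Finset.subset_product
    _ = ∑ v ∈ S.image Prod.fst, ∑ y ∈ S.image Prod.snd, f v y := Finset.sum_product _ _ _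
    _ ≤ _ := hfin _ _

/-- The weighted form of `tsum_tsum_perc_T_ge_le_ofReal`: weights `w v y ≤ 1` (Kronecker complements of the tables)
are dropped first. [cite: FitznerVanDerHofstad2016NoBLE, §5.3.2 (5.41) (PTRF 169 (2017) p. 1098)]
[cite: FitznerVanDerHofstad2017, §4.2 (4.17), (4.18) (arXiv:1506.07977v2 p. 36)] -/
theorem tsum_tsum_mul_perc_T_ge_le_ofReal (hd : 2 ≤ d) (p : unitInterval) (hp : p < criticalProbI d)
    {m₁ m₂ m₃ M : ℕ} (hm : m₂ + m₃ ≤ M) {x : Site d} {X : Set (Site d)} (hx : x ∈ X) {N : ℕ → ℕ}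
    (hN : ∀ L, (trailWordsTo d L x).card ≤ N L) {R₁ R₂ R₃ : ℝ} (hR₁ : IsRemKernelConst d [M] X R₁)
    (hR₂ : IsRemKernelConst d [M - m₃, m₃] X R₂) (hR₃ : IsRemKernelConst d [M - (m₂ + m₃), m₂, m₃] X R₃)
    {w : Site d → Site d → ℝ≥0∞} (hw : ∀ v y, w v y ≤ 1) :
    ∑' v, ∑' y, w v y * (Letters.perc d p).T (.ge m₁) (.ge m₂) (.ge m₃) v y x ≤
      ENNReal.ofReal (triangleSlotR p (nobleSup2 d p) m₁ m₂ m₃ M N R₁ R₂ R₃) := by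
  refine le_trans (ENNReal.tsum_le_tsum fun v => ENNReal.tsum_le_tsum fun y => ?_)
    (tsum_tsum_perc_T_ge_le_ofReal hd p hp hm hx hN hR₁ hR₂ hR₃)
  calc w v y * (Letters.perc d p).T (.ge m₁) (.ge m₂) (.ge m₃) v y x
      ≤ 1 * (Letters.perc d p).T (.ge m₁) (.ge m₂) (.ge m₃) v y x := by gcongr; exact hw v y
    _ = _ := one_mul _

/-- The (5.41) slot for ARBITRARY line indices: an exact index `m̲` is majorised by `≥ m` (`perc_T_le_floor`,
[FvdH17] (4.12)), so `Σ'_v Σ'_y 𝓣_{j₁,j₂,j₃}(v,y,x)` is below the slot at `(⌊j₁⌋, ⌊j₂⌋, ⌊j₃⌋)`.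
[cite: FitznerVanDerHofstad2016NoBLE, §5.3.2 (5.41) (PTRF 169 (2017) p. 1098)]
[cite: FitznerVanDerHofstad2017, §4.2 (4.12), (4.17) (arXiv:1506.07977v2 pp. 35–36)] -/
theorem tsum_tsum_perc_T_le_ofReal_floor (hd : 2 ≤ d) (p : unitInterval) (hp : p < criticalProbI d)
    (j₁ j₂ j₃ : LenIdx) {M : ℕ} (hm : LenIdx.floor j₂ + LenIdx.floor j₃ ≤ M) {x : Site d} {X : Set (Site d)}
    (hx : x ∈ X) {N : ℕ → ℕ} (hN : ∀ L, (trailWordsTo d L x).card ≤ N L) {R₁ R₂ R₃ : ℝ}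
    (hR₁ : IsRemKernelConst d [M] X R₁) (hR₂ : IsRemKernelConst d [M - LenIdx.floor j₃, LenIdx.floor j₃] X R₂)
    (hR₃ : IsRemKernelConst d [M - (LenIdx.floor j₂ + LenIdx.floor j₃), LenIdx.floor j₂, LenIdx.floor j₃] X R₃) :
    ∑' v, ∑' y, (Letters.perc d p).T j₁ j₂ j₃ v y x ≤
      ENNReal.ofReal (triangleSlotR p (nobleSup2 d p) (LenIdx.floor j₁) (LenIdx.floor j₂) (LenIdx.floor j₃)
        M N R₁ R₂ R₃) :=
  (ENNReal.tsum_le_tsum fun v => ENNReal.tsum_le_tsum fun y => perc_T_le_floor p j₁ j₂ j₃ v y x).trans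
    (tsum_tsum_perc_T_ge_le_ofReal hd p hp hm hx hN hR₁ hR₂ hR₃)

/-! ## C. `(A^ι)_{0,2}` in tier P⁺ (peel of the exact first bond + the triangle slot at a unit endpoint) -/

section AiotaZeroTwo

variable (p : unitInterval)

/-- **`(A^ι)_{0,2}` in tier P⁺**: `(A^ι)_{0,2} ≤ 2d · p · triangleSlotR p Γ̄₂ 0 2 1 M N R₁ R₂ R₃` with the trail-word
majorant `N` and the remainder-kernel constants `R₁, R₂, R₃` on the unit-vector endpoint class.  Route: closed form
`matAiota_zero_two` = `Σ'_{x,y} Σ_κ (1−δ_{y,0})(1−δ_{x,0}) S_{1̲,0,2,1}(e_κ,x,y,0)`; drop the Kronecker complements;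
peel the exact first bond (`perc_S_eqOne₁_le_p_mul_T`): `S_{1̲,0,2,1}(e_κ,x,y,0) ≤ p·𝓣_{≥0,≥2,≥1}(x−e_κ,y−e_κ,−e_κ)`;
re-index `(x,y) ↦ (x−e_κ,y−e_κ)`; the (5.41) slot at the endpoint `−e_κ = e_{κ̄}` (`tsum_tsum_perc_T_ge_le_ofReal`);
`2d` values of `κ`.
[cite: FitznerVanDerHofstad2017, App. B Table "definition of A^{ι,a,b}(0,v,x,y)", row (0,2) (arXiv:1506.07977v2 p. 75); §5.1 "Elements of the bounds" (p. 49); §4.2 (4.17) and the sentence after it (p. 36); §6.1 after (6.4) (p. 58)]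
[cite: FitznerVanDerHofstad2016NoBLE, §5.3.2 (5.41) (PTRF 169 (2017) p. 1098)] -/
theorem perc_matAiota_zero_two_le_peel (hd : 2 ≤ d) (hp : p < criticalProbI d) {M : ℕ} (hM : 3 ≤ M)
    {N : ℕ → ℕ} (hN : ∀ L (ι : Fin d × Bool), (trailWordsTo d L (stepVec ι : Site d)).card ≤ N L) {R₁ R₂ R₃ : ℝ}
    (hR₁ : IsRemKernelConst d [M] (Set.range fun ι : Fin d × Bool => (stepVec ι : Site d)) R₁)
    (hR₂ : IsRemKernelConst d [M - 1, 1] (Set.range fun ι : Fin d × Bool => (stepVec ι : Site d)) R₂)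
    (hR₃ : IsRemKernelConst d [M - 3, 2, 1] (Set.range fun ι : Fin d × Bool => (stepVec ι : Site d)) R₃) :
    matAiota (Letters.perc d p) 0 2 ≤
      ENNReal.ofReal (((2 * d : ℕ) : ℝ) * (p : ℝ) * triangleSlotR p (nobleSup2 d p) 0 2 1 M N R₁ R₂ R₃) := by
  classical
  set L := Letters.perc d p with hL
  -- the unit-endpoint triangle slot at `-e_κ = e_{srev κ}`
  have hslot : ∀ κ : Fin d × Bool,
      ∑' x, ∑' y, L.T (.ge 0) (.ge 2) (.ge 1) x y (-(stepVec κ : Site d)) ≤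
        ENNReal.ofReal (triangleSlotR p (nobleSup2 d p) 0 2 1 M N R₁ R₂ R₃) := by
    intro κ
    have hmem : (-(stepVec κ : Site d)) ∈ Set.range fun ι : Fin d × Bool => (stepVec ι : Site d) :=
      ⟨srev κ, by simp⟩
    have hm : 2 + 1 ≤ M := hM
    exact tsum_tsum_perc_T_ge_le_ofReal hd p hp hm hmem (fun K => by simpa using hN K (srev κ)) hR₁
      (by simpa using hR₂) (by simpa using hR₃)
  -- the summand: drop the Kronecker complements, peel the first bond
  have hterm : ∀ (κ : Fin d × Bool) (x y : Site d),
      kdc y 0 * kdc x 0 * L.S (.eq 1) (.ge 0) (.ge 2) (.ge 1) (stepVec κ) x y 0 ≤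
        ENNReal.ofReal p * L.T (.ge 0) (.ge 2) (.ge 1) (x - stepVec κ) (y - stepVec κ) (-(stepVec κ : Site d)) := by
    intro κ x y
    calc kdc y 0 * kdc x 0 * L.S (.eq 1) (.ge 0) (.ge 2) (.ge 1) (stepVec κ) x y 0
        ≤ 1 * 1 * (ENNReal.ofReal p *
            L.T (.ge 0) (.ge 2) (.ge 1) (x - stepVec κ) (y - stepVec κ) (0 - (stepVec κ : Site d))) := by
          gcongr
          · exact kdc_le_one y 0
          · exact kdc_le_one x 0
          · exact perc_S_eqOne₁_le_p_mul_T p (.ge 0) (.ge 2) (.ge 1) (stepVec κ) x y 0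
      _ = _ := by rw [one_mul, one_mul, zero_sub]
  -- re-index each `κ`-slice by `(x,y) ↦ (x - e_κ, y - e_κ)`
  have hre : ∀ κ : Fin d × Bool,
      ∑' x, ∑' y, L.T (.ge 0) (.ge 2) (.ge 1) (x - stepVec κ) (y - stepVec κ) (-(stepVec κ : Site d)) =
        ∑' x, ∑' y, L.T (.ge 0) (.ge 2) (.ge 1) x y (-(stepVec κ : Site d)) := by
    intro κ
    rw [← (Equiv.subRight (stepVec κ : Site d)).tsum_eq
      (fun x => ∑' y, L.T (.ge 0) (.ge 2) (.ge 1) x y (-(stepVec κ : Site d)))]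
    refine tsum_congr fun x => ?_
    rw [← (Equiv.subRight (stepVec κ : Site d)).tsum_eq
      (fun y => L.T (.ge 0) (.ge 2) (.ge 1) (Equiv.subRight (stepVec κ : Site d) x) y (-(stepVec κ : Site d)))]
    rfl
  rw [matAiota_zero_two]
  calc ∑' x, ∑' y, ∑ κ : Fin d × Bool, kdc y 0 * kdc x 0 * L.S (.eq 1) (.ge 0) (.ge 2) (.ge 1) (stepVec κ) x y 0
      ≤ ∑' x, ∑' y, ∑ κ : Fin d × Bool, ENNReal.ofReal p *
          L.T (.ge 0) (.ge 2) (.ge 1) (x - stepVec κ) (y - stepVec κ) (-(stepVec κ : Site d)) :=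
        ENNReal.tsum_le_tsum fun x => ENNReal.tsum_le_tsum fun y => Finset.sum_le_sum fun κ _ => hterm κ x y
    _ = ENNReal.ofReal p * ∑ κ : Fin d × Bool, ∑' x, ∑' y,
          L.T (.ge 0) (.ge 2) (.ge 1) (x - stepVec κ) (y - stepVec κ) (-(stepVec κ : Site d)) := by
        rw [← Summable.tsum_finsetSum (fun _ _ => ENNReal.summable), ← ENNReal.tsum_mul_left]
        refine tsum_congr fun x => ?_
        rw [← Summable.tsum_finsetSum (fun _ _ => ENNReal.summable), ← ENNReal.tsum_mul_left]
        refine tsum_congr fun y => ?_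
        rw [Finset.mul_sum]
    _ = ENNReal.ofReal p * ∑ κ : Fin d × Bool, ∑' x, ∑' y, L.T (.ge 0) (.ge 2) (.ge 1) x y (-(stepVec κ : Site d)) := by
        congr 1
        exact Finset.sum_congr rfl fun κ _ => hre κ
    _ ≤ ENNReal.ofReal p * ∑ κ : Fin d × Bool,
          ENNReal.ofReal (triangleSlotR p (nobleSup2 d p) 0 2 1 M N R₁ R₂ R₃) := by
        gcongr with κ
        exact hslot κ
    _ = ENNReal.ofReal (((2 * d : ℕ) : ℝ) * (p : ℝ) * triangleSlotR p (nobleSup2 d p) 0 2 1 M N R₁ R₂ R₃) := by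
        have h2dp : (0 : ℝ) ≤ ((2 * d : ℕ) : ℝ) * (p : ℝ) := mul_nonneg (Nat.cast_nonneg _) p.2.1
        rw [Finset.sum_const, Finset.card_univ, Fintype.card_prod, Fintype.card_fin, Fintype.card_bool, nsmul_eq_mul,
          ENNReal.ofReal_mul h2dp, ENNReal.ofReal_mul (Nat.cast_nonneg _), ENNReal.ofReal_natCast]
        push_cast
        ring

end AiotaZeroTwo

end Literature.Probability.FitznerVanDerHofstad2017.NobleBlocks

end
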